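import Summits.ValiantsHypothesis.ValiantsHypothesis.Theorems.LacunarySymmetroidMatrixDescartesCensusChamberSignCell

/-!
# `MatrixDescartes` census — DOOR A: the INTERIOR-DEFINITE-LETTER BRIDGE (the cell's conjecture C-g3-2 at `K = 6`
# closes every MIXED chamber of the 2 608-chamber census, in particular the hard chambers 1 and 1709)

HONEST FRAMING.  Object-search cell `pub-symmetroid`, door-A seat `val-sym-door-p4` (gen 15); items
stmt-ValiantsHypothesis-19979 `DoorA26 := PosRootLawAt 2 6 19` / 19980 `DoorA34` (OPEN, typed, never asserted); helper file
`--supports 19979`, NO closure claim.  CONDITIONAL theorems: the hypothesis is the INTERIOR-DEFINITE-LETTER LAW at `(2,6)`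
(«IDL26», the `K = 6` instance of the cell's conjecture C-g3-2, `HOME/CONJECTURE.md` §2.1d, theory g3 — PROVED there only
at `K = 3`; OPEN at `K = 6`, never asserted here), stated INLINE as an explicit `∀`-hypothesis (no definition, no named fact):

  «every real symmetric `2 × 2` six-term pencil `∑ X^{d l} S_l` with an INTERIOR letter (`d k < d l < d k'` for some
   `k, k'`) of positive determinant (`det S_l > 0`, i.e. `S_l` definite of either sign) has at most `19` distinct positive
   det-roots».

MECHANISM (sign level, the cell's C22 dictionary; everything used is in the tree: `Census.card_pairSums_of_chamber`,
`pair_eq_of_chamber`, `card_filter_lt_of_chamber`, `coeff_det_pencil_two_diag`, `pow_rank_mul_coeff_mul_coeff_pos_of_sharp`,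
`support_det_pencil_subset_sumset`).  A twenty on a support of the chamber `σ` is Descartes-sharp, so every coefficient has the
sign `(−1)^{rank + η}` of its orientation `η` (`(−1)^η det S_{i₀} > 0`, `i₀` the letter of the lowest sum); the coefficient at
an uncollided square knot `2d_u` is `det S_u`, so a diagonal position `t` with `t + η` even carries a letter with `det S_u > 0`;
if `0 < t < 20` that letter is interior, and IDL26 caps the count at `19` — contradiction.  A chamber is MIXED when its interior
diagonal positions (letters `1 … 4` in sorted order) have BOTH parities: then each orientation has such a `t`, the degenerate
orientation `det S_{i₀} = 0` loses a monomial (Descartes `≤ 19`), and the door-A row `PosRootLawOn 2 6 19 d` follows on the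
WHOLE chamber from IDL26 alone.

COUNT (this seat, exact, over theory g6's table `HOME/theory/g6/chambers/chambers_2-6.jsonl`; memo `IDL-doorp4g15.md`):
`2 272` of the `2 608` chambers are mixed; of the `1 288` chambers without a kernel row at 2026-08-29T06:33Z, `990` are mixed —
among them the HARD chambers `1` and `1709` of the census line (`stub_hardChambers = [1, 954, 1706, 1709]`), the mirror pair of
the tall flag, where the cell's kernel pseudo-twenties show that no sign/Newton-cone certificate exists.  The `298` remaining
non-mixed chambers (`180` of class `IIIIII`, `118` of class `DIIIID`, one live orientation each) are exactly where the located
eighteens of record live (`208/540` rows all-indefinite, `332/540` rows `+−−−−+`).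

* `no_twenty_on_chamber_cell_of_interiorDefinite` — IDL26 ⇒ the orientation `η` of a chamber with an interior diagonal
  position `t`, `t + η` even, carries no twenty (every `d` of the chamber);
* `posRootLawOn_of_interiorDefinite_mixed` — IDL26 ⇒ `PosRootLawOn 2 6 19 d` for every `d` of a MIXED chamber;
* `doorA26_on_chamber1_of_interiorDefinite`, `doorA26_on_chamber1709_of_interiorDefinite` — the two hard mixed chambers.

Nothing here proves IDL26, bounds `ζ_sym(2,6)`, decides `DoorA26`/`DoorA34`, or bears on `MatrixDescartes`
(stmt-ValiantsHypothesis-18050) / `VP ≠ VNP`.  [folklore] bookkeeping over the cell's sign-class certificate; no citation.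
-/

-- `Summit.ValiantsHypothesis.ValiantsHypothesis.…` repeats a component by the D-0017 layout
-- (single-conjunct summit), which the `dupNamespace` linter flags; the name is mandated.
set_option linter.dupNamespace false

namespace Summit.ValiantsHypothesis.ValiantsHypothesis.Theorems.LacunarySymmetroidMatrixDescartes.Census

open Polynomial Finset
open scoped BigOperators Polynomial Matrix

/-- **IDL26 ⇒ no twenty on an orientation with an interior definite-parity diagonal position.**  Data: an order `σ` of the
21 pairs covering all pairs, `σ 0 = (i₀,i₀)`, `σ 20 = (i₅,i₅)`, an interior diagonal position `σ t = (u,u)` (`0 < t < 20`) and an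
orientation `η` with `t + η` even.  Under the interior-definite-letter law (hypothesis `hIDL`, stated inline), no real symmetric
`2 × 2` pencil on ANY exponent vector `d` of the chamber with `(−1)^η det S_{i₀} > 0` has `20` distinct positive det-roots:
full alternation forces `det S_u > 0` with `d i₀ < d u < d i₅`. [folklore] -/
theorem no_twenty_on_chamber_cell_of_interiorDefinite
    (hIDL : ∀ (d : Fin 6 → ℕ) (S : Fin 6 → Matrix (Fin 2) (Fin 2) ℝ), (∀ l, (S l).IsSymm) →
      ∀ l : Fin 6, (∃ k, d k < d l) → (∃ k, d l < d k) → 0 < S l 0 0 * S l 1 1 - S l 0 1 ^ 2 →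
      ((∑ l, ((X : ℝ[X]) ^ d l) • (S l).map C).det.roots.toFinset.filter (fun t => 0 < t)).card ≤ 19)
    (σ : Fin 21 → Fin 6 × Fin 6) (η : ℕ) (i₀ i₅ u : Fin 6) (t : Fin 21)
    (hcert : (∀ p : Fin 6 × Fin 6, ∃ s : Fin 21, σ s = p ∨ σ s = p.swap) ∧ σ 0 = (i₀, i₀) ∧ σ 20 = (i₅, i₅) ∧
      σ t = (u, u) ∧ 0 < (t : ℕ) ∧ (t : ℕ) < 20 ∧ Even ((t : ℕ) + η))
    (d : Fin 6 → ℕ) (hd : StrictMono ((fun p : Fin 6 × Fin 6 => d p.1 + d p.2) ∘ σ))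
    (S : Fin 6 → Matrix (Fin 2) (Fin 2) ℝ) (hS : ∀ l, (S l).IsSymm)
    (hZ : 20 ≤ ((∑ l, ((X : ℝ[X]) ^ d l) • (S l).map C).det.roots.toFinset.filter (fun t => 0 < t)).card)
    (hs : 0 < (-1 : ℝ) ^ η * (S i₀ 0 0 * S i₀ 1 1 - S i₀ 0 1 ^ 2)) : False := by
  obtain ⟨hcov, h0, h20, ht, ht0, ht20, pt⟩ := hcert
  set P := (∑ l, ((X : ℝ[X]) ^ d l) • (S l).map C).det with hP_def
  set W := (Finset.univ : Finset (Fin 6 × Fin 6)).image (fun p => d p.1 + d p.2) with hW_def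
  have hN : W.card = 21 := card_pairSums_of_chamber σ hcov d hd
  have memW : ∀ a b : Fin 6, d a + d b ∈ W := fun a b =>
    Finset.mem_image.mpr ⟨(a, b), Finset.mem_univ _, rfl⟩
  have hP : P ≠ 0 := by
    intro hP0
    have : (P.roots.toFinset.filter (fun t => 0 < t)).card = 0 := by rw [hP0]; simp
    omega
  have hsupp : P.support = W := by
    have hsub : P.support ⊆ W := by
      rw [hP_def, hW_def, ← sumset_two_eq_pairSums d]; exact support_det_pencil_subset_sumset d S
    refine Finset.eq_of_subset_of_card_le hsub ?_
    have h := Literature.Computability.AlgebraicComplexity.card_roots_toFinset_filter_pos_lt_card_support hP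
    omega
  have hZ' : P.support.card ≤ (P.roots.toFinset.filter (fun t => 0 < t)).card + 1 := by
    rw [hsupp]; omega
  -- F1 in rank form
  have F1 : ∀ x y : ℕ, x ∈ W → y ∈ W →
      0 < (-1 : ℝ) ^ ((W.filter (· < x)).card + (W.filter (· < y)).card) * (P.coeff x * P.coeff y) := by
    intro x y hx hy
    have := pow_rank_mul_coeff_mul_coeff_pos_of_sharp P hZ' (by rw [hsupp]; exact hx) (by rw [hsupp]; exact hy)
    rwa [hsupp] at this
  -- chamber bookkeeping
  have hsum : ∀ {s : Fin 21} {a b : Fin 6}, σ s = (a, b) → d a + d b = d (σ s).1 + d (σ s).2 := by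
    intro s a b hs'; rw [hs']
  have udiag : ∀ {s : Fin 21} {a : Fin 6}, σ s = (a, a) →
      ∀ p : Fin 6 × Fin 6, d p.1 + d p.2 = d a + d a → p = (a, a) := by
    intro s a hs' p hp
    rw [hsum hs'] at hp
    rcases pair_eq_of_chamber σ hcov d hd s p hp with h | h
    · rw [h, hs']
    · rw [h, hs']; rfl
  have rk : ∀ {s : Fin 21} {a b : Fin 6}, σ s = (a, b) → (W.filter (· < d a + d b)).card = s := by
    intro s a b hs'
    rw [hsum hs']
    exact card_filter_lt_of_chamber σ hcov d hd s
  have hsym : ∀ l, S l 1 0 = S l 0 1 := fun l => by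
    have h := congrFun (congrFun (hS l) 1) 0
    simp only [Matrix.transpose_apply] at h
    exact h.symm
  have hdiag : ∀ {s : Fin 21} {a : Fin 6}, σ s = (a, a) → P.coeff (d a + d a) = S a 0 0 * S a 1 1 - S a 0 1 ^ 2 := by
    intro s a hs'; rw [hP_def, coeff_det_pencil_two_diag d S a (udiag hs'), hsym, sq]
  -- every twisted coefficient has the sign of the orientation
  have tw : ∀ x : ℕ, x ∈ W → 0 < (-1 : ℝ) ^ ((W.filter (· < x)).card + η) * P.coeff x := by
    intro x hx
    have h1 := F1 (d i₀ + d i₀) x (memW i₀ i₀) hx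
    rw [rk h0, hdiag h0] at h1
    simp only [Fin.val_zero, zero_add] at h1
    have h2 : 0 < ((-1 : ℝ) ^ (W.filter (· < x)).card * ((S i₀ 0 0 * S i₀ 1 1 - S i₀ 0 1 ^ 2) * P.coeff x)) *
        ((-1 : ℝ) ^ η * (S i₀ 0 0 * S i₀ 1 1 - S i₀ 0 1 ^ 2)) := mul_pos h1 hs
    have h3 : ((-1 : ℝ) ^ (W.filter (· < x)).card * ((S i₀ 0 0 * S i₀ 1 1 - S i₀ 0 1 ^ 2) * P.coeff x)) *
        ((-1 : ℝ) ^ η * (S i₀ 0 0 * S i₀ 1 1 - S i₀ 0 1 ^ 2))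
        = ((-1 : ℝ) ^ ((W.filter (· < x)).card + η) * P.coeff x) * (S i₀ 0 0 * S i₀ 1 1 - S i₀ 0 1 ^ 2) ^ 2 := by
      rw [pow_add]; ring
    rw [h3] at h2
    exact pos_of_mul_pos_left h2 (sq_nonneg _)
  -- the interior letter `u` is definite
  have hdetu : 0 < S u 0 0 * S u 1 1 - S u 0 1 ^ 2 := by
    have := tw _ (memW u u)
    rw [rk ht, pt.neg_one_pow, hdiag ht] at this
    linarith
  -- and interior: `d i₀ < d u < d i₅`
  have hlow : d i₀ < d u := by
    have h := hd (show (0 : Fin 21) < t from Fin.lt_def.mpr (by simpa using ht0))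
    simp only [Function.comp_apply, h0, ht] at h
    omega
  have hhigh : d u < d i₅ := by
    have h := hd (show t < (20 : Fin 21) from Fin.lt_def.mpr (by simpa using ht20))
    simp only [Function.comp_apply, h20, ht] at h
    omega
  have h19 := hIDL d S hS u ⟨i₀, hlow⟩ ⟨i₅, hhigh⟩ hdetu
  rw [← hP_def] at h19
  omega

/-- **IDL26 ⇒ the door-A row on every MIXED chamber.**  If the chamber of `σ` has two interior diagonal positions
`σ t = (u,u)`, `σ s = (v,v)` (`0 < t, s < 20`) of DIFFERENT parity, then under the interior-definite-letter law
`PosRootLawOn 2 6 19 d` holds for every exponent vector `d` of the chamber: both orientations die by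
`no_twenty_on_chamber_cell_of_interiorDefinite`, and `det S_{i₀} = 0` loses a monomial (Descartes `≤ 19`). [folklore] -/
theorem posRootLawOn_of_interiorDefinite_mixed
    (hIDL : ∀ (d : Fin 6 → ℕ) (S : Fin 6 → Matrix (Fin 2) (Fin 2) ℝ), (∀ l, (S l).IsSymm) →
      ∀ l : Fin 6, (∃ k, d k < d l) → (∃ k, d l < d k) → 0 < S l 0 0 * S l 1 1 - S l 0 1 ^ 2 →
      ((∑ l, ((X : ℝ[X]) ^ d l) • (S l).map C).det.roots.toFinset.filter (fun t => 0 < t)).card ≤ 19)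
    (σ : Fin 21 → Fin 6 × Fin 6) (i₀ i₅ u v : Fin 6) (t s : Fin 21)
    (hcert : (∀ p : Fin 6 × Fin 6, ∃ r : Fin 21, σ r = p ∨ σ r = p.swap) ∧ σ 0 = (i₀, i₀) ∧ σ 20 = (i₅, i₅) ∧
      (σ t = (u, u) ∧ 0 < (t : ℕ) ∧ (t : ℕ) < 20 ∧ Even (t : ℕ)) ∧
      (σ s = (v, v) ∧ 0 < (s : ℕ) ∧ (s : ℕ) < 20 ∧ Odd (s : ℕ)))
    (d : Fin 6 → ℕ) (hd : StrictMono ((fun p : Fin 6 × Fin 6 => d p.1 + d p.2) ∘ σ)) :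
    PosRootLawOn 2 6 19 d := by
  obtain ⟨hcov, h0, h20, ⟨ht, ht0, ht20, hte⟩, ⟨hs', hs0, hs20, hso⟩⟩ := hcert
  intro S hS
  by_contra hcon
  have hZ : 20 ≤ ((∑ l, ((X : ℝ[X]) ^ d l) • (S l).map C).det.roots.toFinset.filter (fun t => 0 < t)).card := by
    omega
  rcases lt_trichotomy 0 (S i₀ 0 0 * S i₀ 1 1 - S i₀ 0 1 ^ 2) with hpos | hzero | hneg
  · refine no_twenty_on_chamber_cell_of_interiorDefinite hIDL σ 0 i₀ i₅ u t
      ⟨hcov, h0, h20, ht, ht0, ht20, by simpa using hte⟩ d hd S hS hZ ?_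
    rw [pow_zero, one_mul]; exact hpos
  · -- `det S_{i₀} = 0`: the lowest monomial is missing, Descartes gives `≤ 19`
    set P := (∑ l, ((X : ℝ[X]) ^ d l) • (S l).map C).det with hP_def
    set W := (Finset.univ : Finset (Fin 6 × Fin 6)).image (fun p => d p.1 + d p.2) with hW_def
    have hN : W.card = 21 := card_pairSums_of_chamber σ hcov d hd
    have hq : S i₀ 0 0 * S i₀ 1 1 - S i₀ 0 1 ^ 2 = 0 := hzero.symm
    have hP : P ≠ 0 := by
      intro hP0
      have : (P.roots.toFinset.filter (fun t => 0 < t)).card = 0 := by rw [hP0]; simp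
      omega
    have hsym : S i₀ 1 0 = S i₀ 0 1 := by
      have h := congrFun (congrFun (hS i₀) 1) 0
      simp only [Matrix.transpose_apply] at h
      exact h.symm
    have udiag : ∀ p : Fin 6 × Fin 6, d p.1 + d p.2 = d i₀ + d i₀ → p = (i₀, i₀) := by
      intro p hp
      have hp' : d p.1 + d p.2 = d (σ 0).1 + d (σ 0).2 := by rw [h0]; exact hp
      rcases pair_eq_of_chamber σ hcov d hd 0 p hp' with h | h
      · rw [h, h0]
      · rw [h, h0]; rfl
    have hcoeff : P.coeff (d i₀ + d i₀) = 0 := by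
      rw [hP_def, coeff_det_pencil_two_diag d S i₀ udiag, hsym, ← sq, hq]
    have hsub : P.support ⊆ W.erase (d i₀ + d i₀) := by
      intro x hx
      have hxW : x ∈ W := by
        have : P.support ⊆ W := by
          rw [hP_def, hW_def, ← sumset_two_eq_pairSums d]; exact support_det_pencil_subset_sumset d S
        exact this hx
      refine Finset.mem_erase.mpr ⟨?_, hxW⟩
      intro hxe
      rw [hxe, Polynomial.mem_support_iff] at hx
      exact hx hcoeff
    have hcard : P.support.card ≤ 20 := by
      have h1 := Finset.card_le_card hsub
      have h2 : (W.erase (d i₀ + d i₀)).card = 20 := by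
        rw [Finset.card_erase_of_mem (Finset.mem_image.mpr ⟨(i₀, i₀), Finset.mem_univ _, rfl⟩), hN]
      omega
    have h := Literature.Computability.AlgebraicComplexity.card_roots_toFinset_filter_pos_lt_card_support hP
    omega
  · refine no_twenty_on_chamber_cell_of_interiorDefinite hIDL σ 1 i₀ i₅ v s
      ⟨hcov, h0, h20, hs', hs0, hs20, ?_⟩ d hd S hS hZ ?_
    · obtain ⟨m, hm⟩ := hso; exact ⟨m + 1, by omega⟩
    · rw [pow_one]; linarith

/-! ## The two hard MIXED chambers of the census line: 1 and 1709 (the mirror pair of the tall flag) -/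

/-- **Chamber 1 of theory g6's table** (order type of `(0,16,24,28,29,31)`, mirror 1709; words `DDIIID` / `IIDDDI`;
both orientations Gram-realised at sign level, one of the four HARD chambers `[1, 954, 1706, 1709]` of the census line):
the interior diagonal positions are `6` (letter 1, even) and `11` (letter 2, odd), so the interior-definite-letter law at
`(2,6)` gives the door-A row `PosRootLawOn 2 6 19 d` for EVERY exponent vector of the chamber. [folklore] -/
theorem doorA26_on_chamber1_of_interiorDefinite
    (hIDL : ∀ (d : Fin 6 → ℕ) (S : Fin 6 → Matrix (Fin 2) (Fin 2) ℝ), (∀ l, (S l).IsSymm) →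
      ∀ l : Fin 6, (∃ k, d k < d l) → (∃ k, d l < d k) → 0 < S l 0 0 * S l 1 1 - S l 0 1 ^ 2 →
      ((∑ l, ((X : ℝ[X]) ^ d l) • (S l).map C).det.roots.toFinset.filter (fun t => 0 < t)).card ≤ 19)
    (d : Fin 6 → ℕ)
    (hd : StrictMono ((fun p : Fin 6 × Fin 6 => d p.1 + d p.2) ∘
      ![(0, 0), (0, 1), (0, 2), (0, 3), (0, 4), (0, 5), (1, 1), (1, 2), (1, 3), (1, 4), (1, 5), (2, 2), (2, 3),
        (2, 4), (2, 5), (3, 3), (3, 4), (4, 4), (3, 5), (4, 5), (5, 5)])) :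
    PosRootLawOn 2 6 19 d :=
  posRootLawOn_of_interiorDefinite_mixed hIDL _ 0 5 1 2 6 11 (by decide) d hd

/-- **Chamber 1709 of theory g6's table** (order type of `(0,2,3,7,15,31)` and of the tall flag `(0,2,3,9,100,400)`, mirror
of chamber 1; words `DIIIDD` / `IDDDII`; both orientations Gram-realised at sign level; HARD chamber of the census line with a
kernel pseudo-twenty): the interior diagonal positions are `14` (letter 4, even) and `3` (letter 1, odd), so the
interior-definite-letter law at `(2,6)` gives `PosRootLawOn 2 6 19 d` for EVERY exponent vector of the chamber. [folklore] -/
theorem doorA26_on_chamber1709_of_interiorDefinite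
    (hIDL : ∀ (d : Fin 6 → ℕ) (S : Fin 6 → Matrix (Fin 2) (Fin 2) ℝ), (∀ l, (S l).IsSymm) →
      ∀ l : Fin 6, (∃ k, d k < d l) → (∃ k, d l < d k) → 0 < S l 0 0 * S l 1 1 - S l 0 1 ^ 2 →
      ((∑ l, ((X : ℝ[X]) ^ d l) • (S l).map C).det.roots.toFinset.filter (fun t => 0 < t)).card ≤ 19)
    (d : Fin 6 → ℕ)
    (hd : StrictMono ((fun p : Fin 6 × Fin 6 => d p.1 + d p.2) ∘
      ![(0, 0), (0, 1), (0, 2), (1, 1), (1, 2), (2, 2), (0, 3), (1, 3), (2, 3), (3, 3), (0, 4), (1, 4), (2, 4),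
        (3, 4), (4, 4), (0, 5), (1, 5), (2, 5), (3, 5), (4, 5), (5, 5)])) :
    PosRootLawOn 2 6 19 d :=
  posRootLawOn_of_interiorDefinite_mixed hIDL _ 0 5 4 1 14 3 (by decide) d hd

end Summit.ValiantsHypothesis.ValiantsHypothesis.Theorems.LacunarySymmetroidMatrixDescartes.Census
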